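import Literature.Analysis.FluidPDE.MorreyDataClasses
import Literature.Analysis.FluidPDE.ForwardHeatPotentials
import HarnessLib

/-!
# Morrey classes of smeared and localised data (Lemma 13.6)

Analysis/FluidPDE support file (everything proved, no definitions) in the decomposition of the
named fact `Literature.Analysis.FluidPDE.LemarieRieusset2016.lemma13_6_duhamel`
(`CKNMorreyHolder.lean`: Lemarié-Rieusset 2016, §13.9 Step 3 and the proof of Lemma 13.6,
pp. 474–478, in particular the list of data classes on p. 478). Generic membership criteria used
to place the data of the localised Duhamel formula in the classes of `IsHeatDatum` /
`IsMultiplierDatum`: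

* `rpow_setLIntegral_le_mul` — Jensen on a set of finite measure:
  `(∫_s F)^q ≤ μ(s)^{q-1} ∫_s F^q`, `q > 1`;
* `enorm_smearedData_le`, `integrable_smearedData` — the spatially smeared datum
  `(s, x) ↦ ∫ μ(y - x) G(s, y) dy` of integrable data `G` by a bounded integrable profile `μ` is
  dominated by `‖μ‖_∞ ‖G(s, ·)‖₁` and is integrable;
* `isParabolicMorreyOn_smearedData` — if moreover `G` is spatially supported in a set of finite
  measure and `∫ |G|^p < ∞` (`p > 1`), the smeared datum belongs to `ℳ₂^{p, 5p/2}` (the classes of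
  the slots `γ ∈ ℳ^{q₀, 5q₀/2}` — "`L^{q₀}_t L^∞_x`" — and `η`, p. 478);
* `isParabolicMorreyOn_univ_of_le_indicator_mul` — data dominated by `C · 1_S Ψ` with
  `1_S Ψ ∈ ℳ₂^{p,τ}` are in `ℳ₂^{p,τ}` on the whole space;
* `IsParabolicMorreyOn.setLIntegral_rpow_lt_top` — a Morrey datum on a set inside a cylinder has
  finite `p`-th moment there;
* `multiplierHeatPotential_neg_datum` — `σ(D)W₊ ⊛ (-g) = -(σ(D)W₊ ⊛ g)`.

## References

* P. G. Lemarié-Rieusset, *The Navier–Stokes Problem in the 21st Century*, CRC Press (2016),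
  Lemma 13.6 and its proof, pp. 477–478. [LemarieRieusset2016]
-/

noncomputable section

open MeasureTheory Set Function Filter Metric Real
open scoped ENNReal NNReal Topology

namespace Literature.Analysis.FluidPDE

/-! ### Jensen on a set of finite measure -/

/-- **Jensen / Hölder on a set**: `(∫_s F)^q ≤ μ(s)^{q-1} ∫_s F^q` for `q > 1`. [folklore] -/
theorem rpow_setLIntegral_le_mul {α : Type*} [MeasurableSpace α] (μ : Measure α) (s : Set α)
    {F : α → ℝ≥0∞} (hF : AEMeasurable F (μ.restrict s)) {q : ℝ} (hq : 1 < q) :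
    (∫⁻ x in s, F x ∂μ) ^ q ≤ μ s ^ (q - 1) * ∫⁻ x in s, F x ^ q ∂μ := by
  have hq0 : 0 < q := zero_lt_one.trans hq
  have h := setLIntegral_rpow_le_rpow_mul_measure μ s hF one_pos hq
  simp only [ENNReal.rpow_one] at h
  calc (∫⁻ x in s, F x ∂μ) ^ q
      ≤ ((∫⁻ x in s, F x ^ q ∂μ) ^ (1 / q) * μ s ^ (1 - 1 / q)) ^ q := ENNReal.rpow_le_rpow h hq0.le
    _ = (∫⁻ x in s, F x ^ q ∂μ) * μ s ^ (q - 1) := by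
        rw [ENNReal.mul_rpow_of_nonneg _ _ hq0.le, ← ENNReal.rpow_mul, ← ENNReal.rpow_mul,
          one_div_mul_cancel hq0.ne', ENNReal.rpow_one]
        congr 1
        congr 1
        field_simp
    _ = μ s ^ (q - 1) * ∫⁻ x in s, F x ^ q ∂μ := mul_comm _ _

/-! ### Spatially smeared data -/

section Smeared

variable {μ : EuclideanSpace ℝ (Fin 3) → ℝ} {Cμ : ℝ} {G : ℝ × EuclideanSpace ℝ (Fin 3) → ℝ}

/-- **Pointwise bound of the smeared datum**: `|∫ μ(y - x) G(s, y) dy| ≤ ‖μ‖_∞ ∫ |G(s, y)| dy`. [folklore] -/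
theorem enorm_smearedData_le (hμb : ∀ y, |μ y| ≤ Cμ) (s : ℝ) (x : EuclideanSpace ℝ (Fin 3)) :
    ‖∫ y, μ (y - x) * G (s, y)‖ₑ ≤ ENNReal.ofReal Cμ * ∫⁻ y, ‖G (s, y)‖ₑ := by
  calc ‖∫ y, μ (y - x) * G (s, y)‖ₑ ≤ ∫⁻ y, ‖μ (y - x) * G (s, y)‖ₑ := enorm_integral_le_lintegral_enorm _
    _ ≤ ∫⁻ y, ENNReal.ofReal Cμ * ‖G (s, y)‖ₑ := by
        refine lintegral_mono fun y => ?_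
        rw [enorm_mul]
        gcongr
        rw [Real.enorm_eq_ofReal_abs]
        exact ENNReal.ofReal_le_ofReal (hμb _)
    _ = ENNReal.ofReal Cμ * ∫⁻ y, ‖G (s, y)‖ₑ := lintegral_const_mul' _ _ ENNReal.ofReal_ne_top

/-- The integrand of the smeared datum on `(ℝ × ℝ³) × ℝ³` is measurable. [folklore] -/
theorem measurable_smearedIntegrand (hμm : Measurable μ) (hGm : Measurable G) :
    Measurable fun p : (ℝ × EuclideanSpace ℝ (Fin 3)) × EuclideanSpace ℝ (Fin 3) =>
      μ (p.2 - p.1.2) * G (p.1.1, p.2) :=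
  (hμm.comp (measurable_snd.sub (measurable_snd.comp measurable_fst))).mul
    (hGm.comp ((measurable_fst.comp measurable_fst).prodMk measurable_snd))

/-- **The smeared datum of integrable data by a bounded integrable profile is integrable**
(`‖·‖₁ ≤ ‖μ‖₁ ‖G‖₁`, Tonelli). [folklore] -/
theorem integrable_smearedData (hμm : Measurable μ) (hμi : Integrable μ volume) (hGm : Measurable G)
    (hGi : Integrable G volume) :
    Integrable (fun q : ℝ × EuclideanSpace ℝ (Fin 3) => ∫ y, μ (y - q.2) * G (q.1, y)) volume := by
  have hsm := stronglyMeasurable_smearedData (E := EuclideanSpace ℝ (Fin 3)) hμm hGm (μ := μ) (F := G)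
  refine ⟨hsm.aestronglyMeasurable, ?_⟩
  rw [hasFiniteIntegral_iff_enorm]
  have hmeas := measurable_smearedIntegrand hμm hGm
  -- Tonelli: `∫⁻_q ∫⁻_y |μ(y - q.2)| |G(q.1, y)| = ∫⁻_s ∫⁻_y |G(s, y)| ∫⁻_x |μ(y - x)|`
  have key : ∫⁻ q : ℝ × EuclideanSpace ℝ (Fin 3), ∫⁻ y, ‖μ (y - q.2) * G (q.1, y)‖ₑ =
      (∫⁻ x : EuclideanSpace ℝ (Fin 3), ‖μ x‖ₑ) * ∫⁻ z : ℝ × EuclideanSpace ℝ (Fin 3), ‖G z‖ₑ := by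
    calc ∫⁻ q : ℝ × EuclideanSpace ℝ (Fin 3), ∫⁻ y, ‖μ (y - q.2) * G (q.1, y)‖ₑ
        = ∫⁻ s : ℝ, ∫⁻ x : EuclideanSpace ℝ (Fin 3), ∫⁻ y, ‖μ (y - x) * G (s, y)‖ₑ := by
          rw [Measure.volume_eq_prod, lintegral_prod _ (hmeas.enorm.lintegral_prod_right').aemeasurable]
      _ = ∫⁻ s : ℝ, ∫⁻ y : EuclideanSpace ℝ (Fin 3), ∫⁻ x, ‖μ (y - x) * G (s, y)‖ₑ := by
          refine lintegral_congr fun s => ?_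
          rw [lintegral_lintegral_swap]
          exact ((hμm.comp (measurable_snd.sub measurable_fst)).mul
            (hGm.comp (measurable_const.prodMk measurable_snd))).enorm.aemeasurable
      _ = ∫⁻ s : ℝ, ∫⁻ y : EuclideanSpace ℝ (Fin 3), ‖G (s, y)‖ₑ * ∫⁻ x : EuclideanSpace ℝ (Fin 3), ‖μ x‖ₑ := by
          refine lintegral_congr fun s => lintegral_congr fun y => ?_
          simp_rw [enorm_mul]
          have hm : Measurable (fun x : EuclideanSpace ℝ (Fin 3) => ‖μ (y - x)‖ₑ) :=
            (hμm.comp (measurable_const.sub measurable_id)).enorm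
          rw [lintegral_mul_const _ hm, mul_comm]
          congr 1
          exact lintegral_sub_left_eq_self (μ := (volume : Measure (EuclideanSpace ℝ (Fin 3))))
            (fun x => ‖μ x‖ₑ) y
      _ = (∫⁻ x : EuclideanSpace ℝ (Fin 3), ‖μ x‖ₑ) * ∫⁻ s : ℝ, ∫⁻ y : EuclideanSpace ℝ (Fin 3), ‖G (s, y)‖ₑ := by
          rw [← lintegral_const_mul'' _ (hGm.enorm.lintegral_prod_right').aemeasurable]
          refine lintegral_congr fun s => ?_
          have hm : AEMeasurable (fun y : EuclideanSpace ℝ (Fin 3) => ‖G (s, y)‖ₑ) volume :=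
            (hGm.comp (measurable_const.prodMk measurable_id)).enorm.aemeasurable
          rw [lintegral_mul_const'' _ hm, mul_comm]
      _ = (∫⁻ x : EuclideanSpace ℝ (Fin 3), ‖μ x‖ₑ) * ∫⁻ z : ℝ × EuclideanSpace ℝ (Fin 3), ‖G z‖ₑ := by
          rw [Measure.volume_eq_prod, lintegral_prod _ hGm.enorm.aemeasurable]
  calc ∫⁻ q : ℝ × EuclideanSpace ℝ (Fin 3), ‖∫ y, μ (y - q.2) * G (q.1, y)‖ₑ
      ≤ ∫⁻ q : ℝ × EuclideanSpace ℝ (Fin 3), ∫⁻ y, ‖μ (y - q.2) * G (q.1, y)‖ₑ :=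
        lintegral_mono fun q => enorm_integral_le_lintegral_enorm _
    _ = (∫⁻ x : EuclideanSpace ℝ (Fin 3), ‖μ x‖ₑ) * ∫⁻ z : ℝ × EuclideanSpace ℝ (Fin 3), ‖G z‖ₑ := key
    _ < ∞ := ENNReal.mul_lt_top hμi.2 hGi.2

/-- The smeared datum vanishes on every time slice on which the data vanish. [folklore] -/
theorem smearedData_eq_zero_of_slice {s : ℝ} (hs : ∀ y, G (s, y) = 0) (x : EuclideanSpace ℝ (Fin 3)) :
    ∫ y, μ (y - x) * G (s, y) = 0 := by
  simp [hs]

/-- **The smeared datum is in `ℳ₂^{p, 5p/2}`** when `G` is spatially supported in a set of finite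
measure and `∫ |G|^p < ∞`, `p > 1`: it is dominated by the function of time
`h(s) = ‖μ‖_∞ ∫ |G(s, y)| dy` with `∫ h^p ≤ ‖μ‖_∞^p |B|^{p-1} ∫ |G|^p < ∞` (Jensen on `B`). [folklore] -/
theorem isParabolicMorreyOn_smearedData (hμb : ∀ y, |μ y| ≤ Cμ) (hGm : Measurable G)
    {B : Set (EuclideanSpace ℝ (Fin 3))} (hB : MeasurableSet B) (hBfin : volume B ≠ ∞)
    (hGB : ∀ s y, y ∉ B → G (s, y) = 0) {p : ℝ} (hp : 1 < p) (hGp : ∫⁻ z, ‖G z‖ₑ ^ p < ∞) :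
    IsParabolicMorreyOn univ
      (fun w : ℝ × EuclideanSpace ℝ (Fin 3) => ‖∫ y, μ (y - w.2) * G (w.1, y)‖ₑ) p (5 * p / 2) := by
  have hp0 : 0 < p := zero_lt_one.trans hp
  set h : ℝ → ℝ≥0∞ := fun s => ENNReal.ofReal Cμ * ∫⁻ y, ‖G (s, y)‖ₑ with hh
  have hhm : Measurable h := measurable_const.mul hGm.enorm.lintegral_prod_right'
  refine isParabolicMorreyOn_univ_of_le_time hhm (fun s x => enorm_smearedData_le hμb s x) hp0 ?_
  -- `∫ h^p < ∞`
  have hslice : ∀ s, ∫⁻ y, ‖G (s, y)‖ₑ = ∫⁻ y in B, ‖G (s, y)‖ₑ := by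
    intro s
    rw [← lintegral_indicator hB]
    refine lintegral_congr fun y => ?_
    by_cases hy : y ∈ B
    · rw [indicator_of_mem hy]
    · rw [indicator_of_notMem hy, hGB s y hy, enorm_zero]
  have hJ : ∀ s, (∫⁻ y, ‖G (s, y)‖ₑ) ^ p ≤ volume B ^ (p - 1) * ∫⁻ y, ‖G (s, y)‖ₑ ^ p := by
    intro s
    rw [hslice s]
    refine (rpow_setLIntegral_le_mul volume B
      (hGm.comp (measurable_const.prodMk measurable_id)).enorm.aemeasurable hp).trans ?_
    exact mul_le_mul' le_rfl (setLIntegral_le_lintegral _ _)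
  calc ∫⁻ s, h s ^ p = ∫⁻ s, ENNReal.ofReal Cμ ^ p * (∫⁻ y, ‖G (s, y)‖ₑ) ^ p := by
        refine lintegral_congr fun s => ?_
        rw [hh, ENNReal.mul_rpow_of_nonneg _ _ hp0.le]
    _ ≤ ∫⁻ s, ENNReal.ofReal Cμ ^ p * (volume B ^ (p - 1) * ∫⁻ y, ‖G (s, y)‖ₑ ^ p) :=
        lintegral_mono fun s => mul_le_mul' le_rfl (hJ s)
    _ = ENNReal.ofReal Cμ ^ p * volume B ^ (p - 1) * ∫⁻ s, ∫⁻ y, ‖G (s, y)‖ₑ ^ p := by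
        rw [lintegral_const_mul' _ _ (ENNReal.rpow_ne_top_of_nonneg hp0.le ENNReal.ofReal_ne_top),
          lintegral_const_mul' _ _ (ENNReal.rpow_ne_top_of_nonneg (by linarith) hBfin), mul_assoc]
    _ = ENNReal.ofReal Cμ ^ p * volume B ^ (p - 1) * ∫⁻ z, ‖G z‖ₑ ^ p := by
        rw [Measure.volume_eq_prod, lintegral_prod _ (hGm.enorm.pow_const p).aemeasurable]
    _ < ∞ := by
        refine ENNReal.mul_lt_top (ENNReal.mul_lt_top ?_ ?_) hGp
        · exact ENNReal.rpow_lt_top_of_nonneg hp0.le ENNReal.ofReal_ne_top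
        · exact ENNReal.rpow_lt_top_of_nonneg (by linarith) hBfin

end Smeared

/-! ### Localised data dominated by a Morrey datum -/

/-- **Data dominated by `C · 1_S Ψ` with `1_S Ψ ∈ ℳ₂^{p,τ}` belong to `ℳ₂^{p,τ}` on the whole
space.** [folklore] -/
theorem isParabolicMorreyOn_univ_of_le_indicator_mul {S : Set (ℝ × EuclideanSpace ℝ (Fin 3))}
    {Φ Ψ : ℝ × EuclideanSpace ℝ (Fin 3) → ℝ≥0∞} {p τ : ℝ} (hΨ : IsParabolicMorreyOn S Ψ p τ)
    (hS : MeasurableSet S) (hp : 0 < p) {C : ℝ≥0∞} (hC : C ≠ ∞)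
    (hle : ∀ w, Φ w ≤ C * S.indicator Ψ w) : IsParabolicMorreyOn univ Φ p τ := by
  have h1 : IsParabolicMorreyOn univ (S.indicator Ψ) p τ := (isParabolicMorreyOn_indicator_univ_iff hS hp).2 hΨ
  exact (h1.const_mul hp.le hC).of_le MeasurableSet.univ hp.le fun w _ => hle w

/-- A Morrey datum on a set inside a cylinder has finite `p`-th moment on that set. [folklore] -/
theorem IsParabolicMorreyOn.setLIntegral_rpow_lt_top {S : Set (ℝ × EuclideanSpace ℝ (Fin 3))}
    {Φ : ℝ × EuclideanSpace ℝ (Fin 3) → ℝ≥0∞} {p τ R : ℝ} {z₁ : ℝ × EuclideanSpace ℝ (Fin 3)}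
    (h : IsParabolicMorreyOn S Φ p τ) (hS : S ⊆ FluidPDE.parabolicCylinderCentered R z₁) (hR : 0 < R) :
    ∫⁻ w in S, Φ w ^ p < ∞ := by
  obtain ⟨M, hM⟩ := h
  have h1 := hM z₁ R hR
  rw [inter_eq_right.2 hS] at h1
  exact h1.trans_lt (ENNReal.mul_lt_top ENNReal.coe_lt_top ENNReal.ofReal_lt_top)

/-- The Morrey condition passes to an a.e.-modification. [folklore] -/
theorem IsParabolicMorreyOn.congr_ae {S : Set (ℝ × EuclideanSpace ℝ (Fin 3))}
    {Φ Ψ : ℝ × EuclideanSpace ℝ (Fin 3) → ℝ≥0∞} {p τ : ℝ} (h : IsParabolicMorreyOn S Φ p τ) (hp : 0 ≤ p)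
    (hae : ∀ᵐ w ∂(volume.restrict S), Φ w = Ψ w) : IsParabolicMorreyOn S Ψ p τ :=
  h.of_le_ae hp (by filter_upwards [hae] with w hw; rw [hw])

/-! ### Sign of the datum in the multiplier potential -/

/-- `σ(D)W₊ ⊛ (-g) = -(σ(D)W₊ ⊛ g)`. [folklore] -/
theorem multiplierHeatPotential_neg_datum (ν : ℝ) (σ : EuclideanSpace ℝ (Fin 3) → ℂ)
    (g : ℝ × EuclideanSpace ℝ (Fin 3) → ℝ) (w : ℝ × EuclideanSpace ℝ (Fin 3)) :
    multiplierHeatPotential ν σ (fun z => -g z) w = -multiplierHeatPotential ν σ g w := by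
  unfold multiplierHeatPotential
  rw [← integral_neg]
  refine integral_congr_ae (Eventually.of_forall fun z => ?_)
  simp only [Complex.ofReal_neg, mul_neg]

/-- `W₊ ⊛ (-F) = -(W₊ ⊛ F)`. [folklore] -/
theorem heatPotential_neg_datum (ν : ℝ) (F : ℝ × EuclideanSpace ℝ (Fin 3) → ℝ)
    (w : ℝ × EuclideanSpace ℝ (Fin 3)) :
    heatPotential ν (fun z => -F z) w = -heatPotential ν F w := by
  unfold heatPotential
  rw [← integral_neg]
  refine integral_congr_ae (Eventually.of_forall fun z => ?_)
  simp only [smul_eq_mul, mul_neg]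

end Literature.Analysis.FluidPDE
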